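import Summits.RiemannHypothesis.RiemannHypothesis.Theorems.MotivicDoor.AWS.ForcingUp
import Literature.Analysis.Calculus.SmoothCutoff

/-!
# AWS sprint, GENERATORS-UP (part 3): the choice-free explicit monomial family

HONEST LABEL (verbatim on every AWS file).  One-way implication from a strengthened,
prime-side-only axiom system; the existence of such an object is NOT claimed and is the located
gap; the converse (RH ⇒ existence) is out of scope and, for this axiom system, tautological
rather than informative (AXIOM-CONTENT.md §2; `riemannHypothesis_iff_exists_tautologicalCarrier`).
Framing: lottery ticket at the motivic door; RH probability
negligible; consolation prizes are real: a new semi-local Weil-positivity theorem, or a located gap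
in the Connes–Consani programme, plus the ff-door theorem.

## Content

`monomialBumpFamily` (`AWS/ForcingUp`) is built on Mathlib's `ContDiffBump`, whose profile between
the plateaus goes through `someContDiffBumpBase ℝ` (a `Classical.choice`): the Gram data of its
generators are well defined but have no closed form.  This file is the CHOICE-FREE companion with
the same index set `ℕ × ℕ` and the same plateaus — the family to which the finite carrier levels
bind by name (cell `pub-rhdoor`, CARRIER-DESIGN.md §8):

* `explicitWindow n = Literature.Analysis.Calculus.cutoff (n + 2)`, i.e.
  `t ↦ σ(t + n + 2) · σ(n + 2 − t)` with `σ = Real.smoothTransition`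
  (closed form `σ(x) = e(x) / (e(x) + e(1 − x))`, `e(x) = exp (−1/x)` for `x > 0`, else `0`);
  it equals `1` on `[−(n+1), n+1]` and `0` off `(−(n+2), n+2)`.  All window facts are the tree's
  `cutoff` API (`cutoff_eq_one`, `cutoff_eq_zero`, `abs_cutoff_le_one`, `contDiff_cutoff`,
  `hasDerivAt_cutoff`, `deriv_cutoff_eq_zero_of_lt`, `deriv_cutoff_eq_zero_of_le`,
  `exists_bound_deriv_cutoff`) and are NOT re-proved here; only the `tsupport`/`HasCompactSupport`
  wrappers that file does not carry are added (`ExplicitFamily.*`).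
* `explicitMonomial (n, k) t = t ^ k · explicitWindow n t` (smooth, compactly supported, hence real Weil
  tests: `ExplicitFamily.contDiff_explicitMonomial`, `ExplicitFamily.hasCompactSupport_explicitMonomial`,
  `ForcingUp.isWeilTest_ofReal`).
* `testCombination_explicit_polyCombination`: `u_c = P · explicitWindow n` for the integer
  combination `c = polyCombination n P` of `AWS/ForcingUp` (`P ∈ ℤ[X]`), and
  `tsupport_testCombination_explicit_polyCombination` (`supp u_c ⊆ [−(n+2), n+2]`).
* `explicitMonomial_dense_level` — DENSITY INSIDE ONE WINDOW: if `supp u ⊆ [−n, n]` then for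
  every `ε > 0` there are `N ≥ 1` and `P ∈ ℤ[X]` with `N⁻¹ u_{polyCombination n P}` `ε`-close to
  `u` in `C¹`, uniformly on `ℝ`; the approximants live in the levels `{(n, k) : k ≤ deg P}` of the
  single window `n` (proof: `ForcingUp.exists_int_polynomial_C1_near` on `[−(n+2), n+2]`, then
  `β_n u = u`, `β_n u' = u'`, `β_n' u = 0`, `|β_n| ≤ 1`, `|β_n'| ≤ D`).
* `explicitMonomial_dense` (the `GeneratingFamily.dense` clause with window `R = n + 2`),
  `explicitMonomialFamily : GeneratingFamily`, `explicitMonomialFamily_φ` (closed form).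

Provenance.  Statement list and declaration names as announced to the cell by seat cc-2
(proposal p197725, reviewed: mathematics sound, resubmit with the duplication of
`Literature/Analysis/Calculus/SmoothCutoff` removed); this is that resubmission, written against
the `cutoff` API and `AWS/ForcingUp`.  No zeros of `ζ`, no `RiemannHypothesis`, no Weil functional
enter this file.
-/

noncomputable section

open Complex Set MeasureTheory Filter Polynomial Metric Literature.NumberTheory.LFunctions
open Literature.Analysis.Calculus
open scoped Topology ContDiff Interval

namespace Summit.RiemannHypothesis.RiemannHypothesis.Theorems.MotivicDoor.AWS

/-- The explicit window `β_n = cutoff (n + 2)`: `t ↦ σ(t + n + 2) · σ(n + 2 − t)`,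
`σ = Real.smoothTransition`; equal to `1` on `[−(n+1), n+1]` (`cutoff_eq_one`) and to `0` off
`(−(n+2), n+2)` (`cutoff_eq_zero`). -/
abbrev explicitWindow (n : ℕ) : ℝ → ℝ := cutoff ((n : ℝ) + 2)

/-- The explicit generators `φ_{(n,k)}(t) = t^k β_n(t)`, `β_n = explicitWindow n`
(`(n, k) ∈ ℕ × ℕ`: window index and monomial degree). -/
def explicitMonomial (i : ℕ × ℕ) (t : ℝ) : ℝ := t ^ i.2 * explicitWindow i.1 t

namespace ExplicitFamily

/-- `β_n = 0` off `[−(n+2), n+2]` (there `n + 2 ≤ |t|`, and `cutoff_eq_zero`). -/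
theorem explicitWindow_eq_zero_of_notMem {n : ℕ} {t : ℝ}
    (ht : t ∉ Icc (-((n : ℝ) + 2)) ((n : ℝ) + 2)) : explicitWindow n t = 0 :=
  cutoff_eq_zero (by
    by_contra h
    exact ht (mem_Icc.mpr (abs_le.mp (not_le.mp h).le)))

/-- `β_n' = 0` off `[−(n+2), n+2]` (`deriv_cutoff_eq_zero_of_le`). -/
theorem deriv_explicitWindow_eq_zero_of_notMem {n : ℕ} {t : ℝ}
    (ht : t ∉ Icc (-((n : ℝ) + 2)) ((n : ℝ) + 2)) : deriv (explicitWindow n) t = 0 :=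
  deriv_cutoff_eq_zero_of_le (by
    by_contra h
    exact ht (mem_Icc.mpr (abs_le.mp (not_le.mp h).le)))

/-- `tsupport β_n ⊆ [−(n+2), n+2]`. -/
theorem tsupport_explicitWindow_subset (n : ℕ) :
    tsupport (explicitWindow n) ⊆ Icc (-((n : ℝ) + 2)) ((n : ℝ) + 2) :=
  closure_minimal (fun _ ht ↦ by_contra fun h ↦ ht (explicitWindow_eq_zero_of_notMem h))
    isClosed_Icc

/-- `β_n` has compact support. -/
theorem hasCompactSupport_explicitWindow (n : ℕ) : HasCompactSupport (explicitWindow n) :=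
  isCompact_Icc.of_isClosed_subset (isClosed_tsupport _) (tsupport_explicitWindow_subset n)

/-- The generators are smooth. -/
theorem contDiff_explicitMonomial (i : ℕ × ℕ) : ContDiff ℝ ∞ (explicitMonomial i) :=
  (contDiff_id.pow i.2).mul (contDiff_cutoff _)

/-- The generators are compactly supported. -/
theorem hasCompactSupport_explicitMonomial (i : ℕ × ℕ) :
    HasCompactSupport (explicitMonomial i) :=
  (hasCompactSupport_explicitWindow i.1).mul_left

end ExplicitFamily

open ExplicitFamily ForcingUp

/-- `u_c = P · β_n` for `c = polyCombination n P` (`P ∈ ℤ[X]`). -/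
theorem testCombination_explicit_polyCombination (n : ℕ) (P : ℤ[X]) (t : ℝ) :
    testCombination explicitMonomial (polyCombination n P) t =
      (P.map (Int.castRingHom ℝ)).eval t * explicitWindow n t := by
  rw [polyCombination, testCombination_finset_sum, Finset.sum_apply]
  simp only [testCombination_single_apply]
  rw [eval_map, eval₂_eq_sum, Polynomial.sum_def, Finset.sum_mul]
  refine Finset.sum_congr rfl fun k _ ↦ ?_
  simp only [explicitMonomial, eq_intCast]
  ring

/-- `supp u_c ⊆ [−(n+2), n+2]` for `c = polyCombination n P`. -/
theorem tsupport_testCombination_explicit_polyCombination (n : ℕ) (P : ℤ[X]) :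
    tsupport (testCombination explicitMonomial (polyCombination n P)) ⊆
      Icc (-((n : ℝ) + 2)) ((n : ℝ) + 2) := by
  have h : testCombination explicitMonomial (polyCombination n P) =
      fun s ↦ (P.map (Int.castRingHom ℝ)).eval s * explicitWindow n s :=
    funext (testCombination_explicit_polyCombination n P)
  rw [h]
  exact tsupport_mul_subset_right.trans (tsupport_explicitWindow_subset n)

/-- **Density inside one window.**  If `supp u ⊆ [−n, n]` (`u` a real Weil test function), then
for every `ε > 0` there are `N ≥ 1` and `P ∈ ℤ[X]` such that `N⁻¹ u_c`, `c = polyCombination n P`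
(an integer combination of the generators `t^k β_n(t)`, `k ≤ deg P`, of the single window `n`),
is `ε`-close to `u` in `C¹` uniformly on `ℝ`. -/
theorem explicitMonomial_dense_level {u : ℝ → ℝ} (hu : IsWeilTest fun t ↦ (u t : ℂ)) {n : ℕ}
    (hn : tsupport u ⊆ Icc (-(n : ℝ)) n) {ε : ℝ} (hε : 0 < ε) :
    ∃ (N : ℕ) (P : ℤ[X]), 0 < N ∧
      (∀ t, |u t - (N : ℝ)⁻¹ * testCombination explicitMonomial (polyCombination n P) t| ≤ ε) ∧
      (∀ t, |deriv u t -
        deriv (fun s ↦ (N : ℝ)⁻¹ * testCombination explicitMonomial (polyCombination n P) s) t|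
          ≤ ε) := by
  have hus := contDiff_of_isWeilTest hu
  have hud : Differentiable ℝ u := hus.differentiable (by simp)
  have hudc : Continuous (deriv u) := hus.continuous_deriv (by simp)
  have hRpos : (0 : ℝ) < (n : ℝ) + 2 := by positivity
  have hu_zero : ∀ t, t ∉ tsupport u → u t = 0 := fun t ht ↦ image_eq_zero_of_notMem_tsupport ht
  have hdu_zero : ∀ t, t ∉ tsupport u → deriv u t = 0 := fun t ht ↦
    Function.notMem_support.mp fun h ↦ ht (support_deriv_subset h)
  have hβ_one : ∀ t ∈ tsupport u, explicitWindow n t = 1 := fun t ht ↦ by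
    have h := hn ht
    exact cutoff_eq_one (abs_le.mpr ⟨by linarith [h.1], by linarith [h.2]⟩)
  have hβ'_zero : ∀ t ∈ tsupport u, deriv (explicitWindow n) t = 0 := fun t ht ↦ by
    have h := hn ht
    exact deriv_cutoff_eq_zero_of_lt (abs_lt.mpr ⟨by linarith [h.1], by linarith [h.2]⟩)
  have key1 : ∀ t, u t * explicitWindow n t = u t := fun t ↦ by
    by_cases ht : t ∈ tsupport u
    · rw [hβ_one t ht, mul_one]
    · rw [hu_zero t ht, zero_mul]
  have key2 : ∀ t,
      deriv u t * explicitWindow n t + u t * deriv (explicitWindow n) t = deriv u t := fun t ↦ by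
    by_cases ht : t ∈ tsupport u
    · rw [hβ_one t ht, hβ'_zero t ht]; ring
    · rw [hu_zero t ht, hdu_zero t ht]; ring
  have huR : u (-((n : ℝ) + 2)) = 0 := hu_zero _ fun h ↦ by have := (hn h).1; linarith
  obtain ⟨C, hC0, hC⟩ := exists_bound_deriv_cutoff
  have hC2 : (0 : ℝ) < C + 2 := by linarith
  set η : ℝ := ε / (C + 2) with hη
  have hηpos : 0 < η := div_pos hε hC2
  have hηε : η ≤ ε := div_le_self hε.le (by linarith)
  have hηC : η * 1 + η * C ≤ ε := by
    have : η * (C + 2) = ε := by rw [hη, div_mul_cancel₀ ε hC2.ne']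
    linarith
  obtain ⟨N, P, hN, hP⟩ := exists_int_polynomial_C1_near hud hudc hRpos huR hηpos
  set q : ℝ → ℝ := fun s ↦ (N : ℝ)⁻¹ * (P.map (Int.castRingHom ℝ)).eval s with hq
  set q' : ℝ → ℝ := fun s ↦ (N : ℝ)⁻¹ * (derivative (P.map (Int.castRingHom ℝ))).eval s
    with hq'
  have hv : (fun s ↦ (N : ℝ)⁻¹ * testCombination explicitMonomial (polyCombination n P) s) =
      fun s ↦ q s * explicitWindow n s := by
    funext s; rw [testCombination_explicit_polyCombination]; simp only [hq]; ring
  have hvd : ∀ t, HasDerivAt (fun s ↦ q s * explicitWindow n s)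
      (q' t * explicitWindow n t + q t * deriv (explicitWindow n) t) t := fun t ↦ by
    have h1 : HasDerivAt q (q' t) t := by
      simpa [hq, hq'] using ((P.map (Int.castRingHom ℝ)).hasDerivAt t).const_mul ((N : ℝ)⁻¹)
    exact h1.mul (hasDerivAt_cutoff _ t).differentiableAt.hasDerivAt
  refine ⟨N, P, hN, fun t ↦ ?_, fun t ↦ ?_⟩
  · have e : u t - (N : ℝ)⁻¹ * testCombination explicitMonomial (polyCombination n P) t =
        (u t - q t) * explicitWindow n t := by
      rw [show (N : ℝ)⁻¹ * testCombination explicitMonomial (polyCombination n P) t =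
        q t * explicitWindow n t from congrFun hv t, sub_mul, key1 t]
    rw [e, abs_mul]
    by_cases ht : t ∈ Icc (-((n : ℝ) + 2)) ((n : ℝ) + 2)
    · calc |u t - q t| * |explicitWindow n t| ≤ η * 1 :=
            mul_le_mul (hP t ht).1 (abs_cutoff_le_one _ t) (abs_nonneg _) hηpos.le
        _ ≤ ε := by linarith
    · rw [explicitWindow_eq_zero_of_notMem ht, abs_zero, mul_zero]
      exact hε.le
  · rw [hv, (hvd t).deriv]
    have e : deriv u t - (q' t * explicitWindow n t + q t * deriv (explicitWindow n) t) =
        (deriv u t - q' t) * explicitWindow n t + (u t - q t) * deriv (explicitWindow n) t := by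
      linear_combination - key2 t
    rw [e]
    by_cases ht : t ∈ Icc (-((n : ℝ) + 2)) ((n : ℝ) + 2)
    · calc |(deriv u t - q' t) * explicitWindow n t + (u t - q t) * deriv (explicitWindow n) t|
            ≤ |(deriv u t - q' t) * explicitWindow n t|
                + |(u t - q t) * deriv (explicitWindow n) t| := abs_add_le _ _
        _ = |deriv u t - q' t| * |explicitWindow n t|
                + |u t - q t| * |deriv (explicitWindow n) t| := by rw [abs_mul, abs_mul]
        _ ≤ η * 1 + η * C :=
            add_le_add
              (mul_le_mul (hP t ht).2 (abs_cutoff_le_one _ t) (abs_nonneg _) hηpos.le)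
              (mul_le_mul (hP t ht).1 (hC _ t) (abs_nonneg _) hηpos.le)
        _ ≤ ε := hηC
    · rw [explicitWindow_eq_zero_of_notMem ht, deriv_explicitWindow_eq_zero_of_notMem ht]
      simp [hε.le]

/-- **Density of the explicit monomial family** (the `GeneratingFamily.dense` clause): for
`supp u ⊆ [−n, n]` take the window `R = n + 2` and the approximants of
`explicitMonomial_dense_level`, which are supported in `[−R, R]`. -/
theorem explicitMonomial_dense (u : ℝ → ℝ) (hu : IsWeilTest fun t ↦ (u t : ℂ)) :
    ∃ R : ℝ, 0 < R ∧ tsupport u ⊆ Icc (-R) R ∧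
      ∀ ε : ℝ, 0 < ε → ∃ (N : ℕ) (c : ℕ × ℕ →₀ ℤ), 0 < N ∧
        tsupport (testCombination explicitMonomial c) ⊆ Icc (-R) R ∧
        (∀ t, |u t - (N : ℝ)⁻¹ * testCombination explicitMonomial c t| ≤ ε) ∧
        (∀ t, |deriv u t - deriv (fun s ↦ (N : ℝ)⁻¹ * testCombination explicitMonomial c s) t|
          ≤ ε) := by
  obtain ⟨n, hn⟩ := exists_nat_tsupport_subset (hasCompactSupport_of_isWeilTest hu)
  refine ⟨(n : ℝ) + 2, by positivity, hn.trans (Icc_subset_Icc (by linarith) (by linarith)),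
    fun ε hε ↦ ?_⟩
  obtain ⟨N, P, hN, h0, h1⟩ := explicitMonomial_dense_level hu hn hε
  exact ⟨N, polyCombination n P, hN, tsupport_testCombination_explicit_polyCombination n P, h0, h1⟩

/-- **The explicit (choice-free) monomial generating family** `φ_{(n,k)}(t) = t^k β_n(t)`,
`β_n = cutoff (n + 2)`, `(n, k) ∈ ℕ × ℕ`, with the forcing (density) property PROVED
(`explicitMonomial_dense`).  Its finite truncation levels `{(n, k) : k ≤ K}` are the levels to
which the carrier search binds; every generator has a closed form (`explicitMonomialFamily_φ`). -/
def explicitMonomialFamily : GeneratingFamily where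
  ι := ℕ × ℕ
  φ := explicitMonomial
  isWeilTest i := isWeilTest_ofReal (contDiff_explicitMonomial i) (hasCompactSupport_explicitMonomial i)
  dense := explicitMonomial_dense

/-- Closed form of the generators of `explicitMonomialFamily`:
`φ_{(n,k)}(t) = t^k · σ(t + (n + 2)) · σ((n + 2) − t)`, `σ = Real.smoothTransition`. -/
theorem explicitMonomialFamily_φ (i : ℕ × ℕ) (t : ℝ) :
    explicitMonomialFamily.φ i t =
      t ^ i.2 * (Real.smoothTransition (t + ((i.1 : ℝ) + 2)) *
        Real.smoothTransition (((i.1 : ℝ) + 2) - t)) := rfl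

end Summit.RiemannHypothesis.RiemannHypothesis.Theorems.MotivicDoor.AWS
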